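import Summits.ResolutionOfSingularities.ResolutionOfSingularities.Theorems.TightDefectStrongWalks
import Literature.Barriers.ResolutionOfSingularities.ResidualOrderUnboundedNarrow
import Summits.ResolutionOfSingularities.ResolutionOfSingularities.Theorems.FrobeniusDescentStates
import HarnessLib

/-!
# FrobeniusDescentClasses — §§3–4 of the node `FrobeniusDescent` (decomp-res lens-5 g12)

The column PIECES on the exponent axis `e` of the purely inseparable heads `x^{pᵉ} + F(y)` (`WalksTerminateAt p e`,
`DefectWalksTerminateAt`, `PrimWalksTerminateAt`, `PrimDefectWalksTerminateAt`; the `∀`-shapes `PrimWalksTerminate`,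
`PrimDefectWalksTerminateDeep` = THE LOCATED RESIDUAL (REDUCED heads, `e ≥ 2`), `DefectWalksTerminateOne` = the `e = 1`
column [KNOWN-MOD-PORT], the column-wise realisation port `ShallowRealisation`) and the PROVED carve:
`W_{e+1} ⟺ Prim_{e+1} ∧ W_e`, antitone columns, `WalksTerminate ⟺ PrimWalksTerminate`,
`DefectWalksTerminateDeep ⟺ PrimDefectWalksTerminateDeep ∧ DefectWalksTerminateOne`, and the MODEL-FIDELITY finding
`DefectWalksTerminateDeep ⟺ DefectWalksTerminate ⟺ WalksTerminate`.  Theses-free; the wiring to the `MaxContactCut`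
asides is `Theorems.MaxContactCutFrobeniusDescent`.  0 `sorry`.  Blocker-first docstring: `Theorems.FrobeniusDescentAlgebra`.
-/

noncomputable section

open MvPolynomial
open Literature.AlgebraicGeometry.Resolution
open Literature.AlgebraicGeometry.Resolution.Hauser2010
open Literature.AlgebraicGeometry.Resolution.PointBlowup
open Literature.Barriers.ResolutionOfSingularities.HauserPerlega
open Summit.ResolutionOfSingularities.ResolutionOfSingularities.Theorems.TightDefectClasses
open Summit.ResolutionOfSingularities.ResolutionOfSingularities.Theorems.TightDefectStrongWalks

open Summit.ResolutionOfSingularities.ResolutionOfSingularities.Theorems.FrobeniusDescentAlgebra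
open Summit.ResolutionOfSingularities.ResolutionOfSingularities.Theorems.FrobeniusDescentStates

namespace Summit.ResolutionOfSingularities.ResolutionOfSingularities.Theorems.FrobeniusDescentClasses

/-! ## §3 The pieces (|σ| = 3, all perfect `K` of characteristic `p`; binders verbatim as in `TightDefectClasses`) -/

/-- Column `e` of `WalksTerminate`: no infinite forced walk at exponent `pᵉ` from a root state. DEFINITION (support). -/
def WalksTerminateAt (p e : ℕ) : Prop :=
  ∀ (K : Type) [Field K] [CharP K p] [PerfectField K] [DecidableEq K] (s₀ : State (Fin 3) K),
    IsRoot (p ^ e) s₀ → ForcedWalk (p ^ e) s₀ → False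

/-- Column `e` of `DefectWalksTerminate` (positive tight defect at every stage). DEFINITION (support). -/
def DefectWalksTerminateAt (p e : ℕ) : Prop :=
  ∀ (K : Type) [Field K] [CharP K p] [PerfectField K] [DecidableEq K] (s₀ : State (Fin 3) K),
    IsRoot (p ^ e) s₀ → ∀ W : ForcedWalk (p ^ e) s₀, (∀ i, 1 ≤ (W.st i).shade) → False

/-- **PRIMITIVE column `e`**: no infinite forced walk at exponent `pᵉ` from a root state whose residual polynomial is
PRIMITIVE (`F ∉ K[yᵖ]`). DEFINITION (support). -/
def PrimWalksTerminateAt (p e : ℕ) : Prop :=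
  ∀ (K : Type) [Field K] [CharP K p] [PerfectField K] [DecidableEq K] (s₀ : State (Fin 3) K),
    IsRoot (p ^ e) s₀ → Primitive p s₀.F → ForcedWalk (p ^ e) s₀ → False

/-- Primitive column `e` with positive tight defect throughout. DEFINITION (support). -/
def PrimDefectWalksTerminateAt (p e : ℕ) : Prop :=
  ∀ (K : Type) [Field K] [CharP K p] [PerfectField K] [DecidableEq K] (s₀ : State (Fin 3) K),
    IsRoot (p ^ e) s₀ → Primitive p s₀.F → ∀ W : ForcedWalk (p ^ e) s₀, (∀ i, 1 ≤ (W.st i).shade) → False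

/-- **`PrimWalksTerminate`** — the model has no infinite forced walk from a PRIMITIVE root state (all `e ≥ 1`).
[piece · ⟺ `WalksTerminate` (`walksTerminate_iff_prim`, PROVED by Frobenius descent + induction on `e`) · the
re-located residual: PRIMITIVE heads only] -/
def PrimWalksTerminate : Prop :=
  ∀ p : ℕ, p.Prime → ∀ e : ℕ, 1 ≤ e → PrimWalksTerminateAt p e

/-- **`PrimDefectWalksTerminateDeep` — THE RE-LOCATED DEEP RESIDUAL**: no infinite forced walk at exponent `pᵉ`,
`e ≥ 2`, from a PRIMITIVE root keeps positive tight defect at every stage.  [UNDECIDED · IDEA-NEEDED · WEAKER than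
31770 by letter (`primDefectDeep_of_defectDeep`) · ⟺ 31770 modulo the `e = 1` model column
(`defectDeep_iff_prim_and_one`)] -/
def PrimDefectWalksTerminateDeep : Prop :=
  ∀ p : ℕ, p.Prime → ∀ e : ℕ, 2 ≤ e → PrimDefectWalksTerminateAt p e

/-- **`DefectWalksTerminateOne` — the `e = 1` MODEL column** (heads `x^p + F`, `F` cleaned hence primitive): no infinite
forced walk at exponent `p` with positive tight defect throughout.  [KNOWN-MOD-PORT: = `WalksTerminateAt p 1`
(`walksAt_iff_defectAt`, `strongWalksTerminate` PROVED) ⟸ `PolyPureTowersTerminateShallow` (CP2019 Thm 1.5 (i) via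
`ShallowColumnPort`) through the column-wise realisation port `ShallowRealisation`] -/
def DefectWalksTerminateOne : Prop :=
  ∀ p : ℕ, p.Prime → DefectWalksTerminateAt p 1

/-- **PORT `ShallowRealisation`** — the tree's `TowerRealisation` (Hartshorne II.7.16: an infinite forced model walk from a
root IS an infinite forced tower rooted at the polynomial pure head) READ AT `e = 1`.  [KNOWN-MOD-PORT(M) · COSTUME(cite) ·
counted 0 · hypothesis of `defectOne_of_cp` only]  (Sources: Hauser2010 §F; Hartshorne1977 II.7.16.) -/
def ShallowRealisation : Prop :=
  PolyPureTowersTerminateShallow → ∀ p : ℕ, p.Prime → WalksTerminateAt p 1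

/-! ### Descent and lift of the column statements (generic exponent `q ↦ p q`) -/

section Aux

variable {K : Type} [Field K] (p : ℕ) [hp : Fact p.Prime] [CharP K p] [PerfectField K] [DecidableEq K]

/-- **DESCENT of a column**: walks at exponent `pq` terminate if the PRIMITIVE ones do and walks at exponent `q` do
(an imprimitive root is the Frobenius `(G^p, 0)` of the root `(G, 0)` over the perfect `K`). [folklore] -/
theorem walks_descent (q : ℕ)
    (hP : ∀ s₀ : State (Fin 3) K, IsRoot (p * q) s₀ → Primitive p s₀.F → ForcedWalk (p * q) s₀ → False)
    (hW : ∀ s₀ : State (Fin 3) K, IsRoot q s₀ → ForcedWalk q s₀ → False)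
    (s₀ : State (Fin 3) K) (hs : IsRoot (p * q) s₀) (W : ForcedWalk (p * q) s₀) : False := by
  by_cases hprim : Primitive p s₀.F
  · exact hP s₀ hs hprim W
  · obtain ⟨G, hG⟩ := exists_eq_pow_of_not_primitive p hprim
    have hs₀ : s₀ = frobState p ⟨G, 0⟩ := state_eq (by simp [hG]) (by simp [hs.1])
    subst hs₀
    exact hW ⟨G, 0⟩ ((isRoot_frobState_iff p q _).mp hs) (descendWalk p W)

omit [PerfectField K] in
/-- **LIFT of a column**: walks at exponent `q` terminate if walks at exponent `pq` do. [folklore] -/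
theorem walks_lift (q : ℕ) (h : ∀ s₀ : State (Fin 3) K, IsRoot (p * q) s₀ → ForcedWalk (p * q) s₀ → False)
    (s₀ : State (Fin 3) K) (hs : IsRoot q s₀) (W : ForcedWalk q s₀) : False :=
  h (frobState p s₀) ((isRoot_frobState_iff p q s₀).mpr hs) (liftWalk p W)

/-- Descent of a column, with positive tight defect (shades divide by `p`). [folklore] -/
theorem defect_descent (q : ℕ)
    (hP : ∀ s₀ : State (Fin 3) K, IsRoot (p * q) s₀ → Primitive p s₀.F →
      ∀ W : ForcedWalk (p * q) s₀, (∀ i, 1 ≤ (W.st i).shade) → False)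
    (hD : ∀ s₀ : State (Fin 3) K, IsRoot q s₀ → ∀ W : ForcedWalk q s₀, (∀ i, 1 ≤ (W.st i).shade) → False)
    (s₀ : State (Fin 3) K) (hs : IsRoot (p * q) s₀) (W : ForcedWalk (p * q) s₀) (hsh : ∀ i, 1 ≤ (W.st i).shade) :
    False := by
  by_cases hprim : Primitive p s₀.F
  · exact hP s₀ hs hprim W hsh
  · obtain ⟨G, hG⟩ := exists_eq_pow_of_not_primitive p hprim
    have hs₀ : s₀ = frobState p ⟨G, 0⟩ := state_eq (by simp [hG]) (by simp [hs.1])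
    subst hs₀
    refine hD ⟨G, 0⟩ ((isRoot_frobState_iff p q _).mp hs) (descendWalk p W) fun i => (one_le_mul_iff p _).mp ?_
    rw [← shade_st_eq_descend p W i]
    exact hsh i

omit [PerfectField K] in
/-- Lift of a column, with positive tight defect (shades multiply by `p`). [folklore] -/
theorem defect_lift (q : ℕ)
    (h : ∀ s₀ : State (Fin 3) K, IsRoot (p * q) s₀ → ∀ W : ForcedWalk (p * q) s₀,
      (∀ i, 1 ≤ (W.st i).shade) → False)
    (s₀ : State (Fin 3) K) (hs : IsRoot q s₀) (W : ForcedWalk q s₀) (hsh : ∀ i, 1 ≤ (W.st i).shade) : False := by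
  refine h (frobState p s₀) ((isRoot_frobState_iff p q s₀).mpr hs) (liftWalk p W) fun i => ?_
  rw [shade_st_liftWalk]
  exact (one_le_mul_iff p _).mpr (hsh i)

end Aux

/-! ## §4 Kernels (PROVED) -/

section Kernels

variable {p : ℕ}

/-- `WalksTerminate` is the conjunction of its columns. [folklore] -/
theorem walksTerminate_iff_at : WalksTerminate ↔ ∀ p : ℕ, p.Prime → ∀ e : ℕ, 1 ≤ e → WalksTerminateAt p e :=
  ⟨fun h p hp e he K _ _ _ _ s₀ hs W => h p hp e he K s₀ hs W,
    fun h p hp e he K _ _ _ _ s₀ hs W => h p hp e he K s₀ hs W⟩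

/-- `DefectWalksTerminate` is the conjunction of its columns. [folklore] -/
theorem defectWalksTerminate_iff_at :
    DefectWalksTerminate ↔ ∀ p : ℕ, p.Prime → ∀ e : ℕ, 1 ≤ e → DefectWalksTerminateAt p e :=
  ⟨fun h p hp e he K _ _ _ _ s₀ hs W hW => h p hp e he K s₀ hs W hW,
    fun h p hp e he K _ _ _ _ s₀ hs W hW => h p hp e he K s₀ hs W hW⟩

/-- `DefectWalksTerminateDeep` (31770) is the conjunction of its columns `e ≥ 2`. [folklore] -/
theorem defectWalksTerminateDeep_iff_at :
    DefectWalksTerminateDeep ↔ ∀ p : ℕ, p.Prime → ∀ e : ℕ, 2 ≤ e → DefectWalksTerminateAt p e :=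
  ⟨fun h p hp e he K _ _ _ _ s₀ hs W hW => h p hp e he K s₀ hs W hW,
    fun h p hp e he K _ _ _ _ s₀ hs W hW => h p hp e he K s₀ hs W hW⟩

/-- Column-wise `walksTerminate_iff_defect` (the PROVED `strongWalksTerminate` at each `e ≥ 1`). [folklore] -/
theorem walksAt_iff_defectAt (hp : p.Prime) {e : ℕ} (he : 1 ≤ e) : WalksTerminateAt p e ↔ DefectWalksTerminateAt p e := by
  refine ⟨fun h K _ _ _ _ s₀ hs W _ => h K s₀ hs W, fun h K _ _ _ _ s₀ hs W => ?_⟩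
  by_cases h0 : ∃ i, (W.st i).shade = 0
  · exact strongWalksTerminate p hp e he K s₀ hs W h0
  · exact h K s₀ hs W (fun i => Order.one_le_iff_ne_zero.mpr (fun h' => h0 ⟨i, h'⟩))

/-- **Column `0` is empty**: a root at exponent `1` has `F = 0` (every monomial is a first power), and `F = 0` has no
isolated top point. [folklore] -/
theorem walksTerminateAt_zero (p : ℕ) : WalksTerminateAt p 0 := by
  intro K _ _ _ _ s₀ hs W
  have hF : s₀.F = 0 := by
    rw [← hs.2.1, pow_zero]
    ext d
    rw [coeff_deletePthPowers, if_pos ((isPthPowerExponent_iff _ _).mpr fun i => one_dvd _), coeff_zero]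
  have h := W.isolated 0
  rw [W.st_zero, pow_zero] at h
  exact ne_zero_of_isolatedTop h hF

/-- **DESCENT KERNEL (one column up)**: `W_{e+1} ⟸ Prim_{e+1} ∧ W_e`. [folklore] -/
theorem walksAt_succ_of_prim_of_walksAt (hp : p.Prime) {e : ℕ} (hP : PrimWalksTerminateAt p (e + 1))
    (hW : WalksTerminateAt p e) : WalksTerminateAt p (e + 1) := by
  haveI := Fact.mk hp
  intro K _ _ _ _
  have hP' := hP K
  rw [pow_succ'] at hP' ⊢
  exact walks_descent p (p ^ e) hP' (hW K)

/-- **LIFT KERNEL (one column down)**: `W_{e+1} ⟹ W_e`. [folklore] -/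
theorem walksAt_of_succ (hp : p.Prime) {e : ℕ} (h : WalksTerminateAt p (e + 1)) : WalksTerminateAt p e := by
  haveI := Fact.mk hp
  intro K _ _ _ _
  have h' := h K
  rw [pow_succ'] at h'
  exact walks_lift p (p ^ e) h'

/-- Primitive column ⟸ column (an extra hypothesis). [folklore] -/
theorem primAt_of_walksAt {e : ℕ} (h : WalksTerminateAt p e) : PrimWalksTerminateAt p e :=
  fun K _ _ _ _ s₀ hs _ W => h K s₀ hs W

/-- **At `e = 1` the carve is trivial**: a root at exponent `p` is primitive (cleaned of `p`-th powers and non-zero by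
isolation), so `Prim_1 = W_1` — the primitive/imprimitive dichotomy only bites for `e ≥ 2`. [folklore] -/
theorem primAt_one_iff (p : ℕ) : PrimWalksTerminateAt p 1 ↔ WalksTerminateAt p 1 := by
  refine ⟨fun h K _ _ _ _ s₀ hs W => ?_, primAt_of_walksAt⟩
  have hiso := W.isolated 0
  rw [W.st_zero, pow_one] at hiso
  have hs' := hs.2.1
  rw [pow_one] at hs'
  exact h K s₀ hs (primitive_of_clean_one p hs' (ne_zero_of_isolatedTop hiso)) W

/-- **EXACT one-column carve**: `W_{e+1} ⟺ Prim_{e+1} ∧ W_e`. [folklore] -/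
theorem walksAt_succ_iff (hp : p.Prime) (e : ℕ) :
    WalksTerminateAt p (e + 1) ↔ PrimWalksTerminateAt p (e + 1) ∧ WalksTerminateAt p e :=
  ⟨fun h => ⟨primAt_of_walksAt h, walksAt_of_succ hp h⟩, fun h => walksAt_succ_of_prim_of_walksAt hp h.1 h.2⟩

/-- **The columns are ANTITONE in `e`** (lift): `e ≤ e' → W_{e'} → W_e`; the bad exponents form an up-set. [folklore] -/
theorem walksAt_antitone (hp : p.Prime) {e e' : ℕ} (hle : e ≤ e') (h : WalksTerminateAt p e') : WalksTerminateAt p e := by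
  induction e', hle using Nat.le_induction with
  | base => exact h
  | succ e' _ ih => exact ih (walksAt_of_succ hp h)

/-- **All columns from the primitive columns** (descent + induction on `e`, base = the empty column `0`). [folklore] -/
theorem walksAt_of_prim (hp : p.Prime) (hP : ∀ e, 1 ≤ e → PrimWalksTerminateAt p e) : ∀ e, WalksTerminateAt p e
  | 0 => walksTerminateAt_zero p
  | e + 1 => walksAt_succ_of_prim_of_walksAt hp (hP (e + 1) e.succ_pos) (walksAt_of_prim hp hP e)

/-- **EXACT: `WalksTerminate ⟺ PrimWalksTerminate`** — the located residual of the forced-tower leaf (mod the tree's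
translation ports) is carried by the PRIMITIVE heads alone. [folklore] -/
theorem walksTerminate_iff_prim : WalksTerminate ↔ PrimWalksTerminate :=
  ⟨fun h p hp e he => primAt_of_walksAt ((walksTerminate_iff_at.mp h) p hp e he),
    fun h => walksTerminate_iff_at.mpr fun p hp e _ => walksAt_of_prim hp (h p hp) e⟩

/-! ### The same carve with positive tight defect (31770) -/

/-- Descent with defect: `D_{e+1} ⟸ PrimD_{e+1} ∧ D_e`. [folklore] -/
theorem defectAt_succ_of_prim_of_defectAt (hp : p.Prime) {e : ℕ} (hP : PrimDefectWalksTerminateAt p (e + 1))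
    (hD : DefectWalksTerminateAt p e) : DefectWalksTerminateAt p (e + 1) := by
  haveI := Fact.mk hp
  intro K _ _ _ _
  have hP' := hP K
  rw [pow_succ'] at hP' ⊢
  exact defect_descent p (p ^ e) hP' (hD K)

/-- Lift with defect: `D_{e+1} ⟹ D_e`. [folklore] -/
theorem defectAt_of_succ (hp : p.Prime) {e : ℕ} (h : DefectWalksTerminateAt p (e + 1)) : DefectWalksTerminateAt p e := by
  haveI := Fact.mk hp
  intro K _ _ _ _
  have h' := h K
  rw [pow_succ'] at h'
  exact defect_lift p (p ^ e) h'

/-- Primitive defect column ⟸ defect column. [folklore] -/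
theorem primDefectAt_of_defectAt {e : ℕ} (h : DefectWalksTerminateAt p e) : PrimDefectWalksTerminateAt p e :=
  fun K _ _ _ _ s₀ hs _ W hsh => h K s₀ hs W hsh

/-- **EXACT one-column carve with defect**: `D_{e+1} ⟺ PrimD_{e+1} ∧ D_e`. [folklore] -/
theorem defectAt_succ_iff (hp : p.Prime) (e : ℕ) :
    DefectWalksTerminateAt p (e + 1) ↔ PrimDefectWalksTerminateAt p (e + 1) ∧ DefectWalksTerminateAt p e :=
  ⟨fun h => ⟨primDefectAt_of_defectAt h, defectAt_of_succ hp h⟩, fun h => defectAt_succ_of_prim_of_defectAt hp h.1 h.2⟩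

/-- The defect columns are antitone in `e`. [folklore] -/
theorem defectAt_antitone (hp : p.Prime) {e e' : ℕ} (hle : e ≤ e') (h : DefectWalksTerminateAt p e') :
    DefectWalksTerminateAt p e := by
  induction e', hle using Nat.le_induction with
  | base => exact h
  | succ e' _ ih => exact ih (defectAt_of_succ hp h)

/-- Deep defect columns from the primitive deep columns and the column `e = 1` (induction on `e ≥ 2`). [folklore] -/
theorem defectAt_of_prim_of_one (hp : p.Prime) (hP : ∀ e, 2 ≤ e → PrimDefectWalksTerminateAt p e)
    (h1 : DefectWalksTerminateAt p 1) : ∀ e, 1 ≤ e → DefectWalksTerminateAt p e := by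
  intro e he
  induction e, he using Nat.le_induction with
  | base => exact h1
  | succ e he ih => exact defectAt_succ_of_prim_of_defectAt hp (hP (e + 1) (Nat.succ_le_succ he)) ih

/-- **NECESSITY: 31770 ⟹ the primitive deep residual** (an extra hypothesis; WEAKER by letter). [folklore] -/
theorem primDefectDeep_of_defectDeep (h : DefectWalksTerminateDeep) : PrimDefectWalksTerminateDeep :=
  fun p hp e he => primDefectAt_of_defectAt ((defectWalksTerminateDeep_iff_at.mp h) p hp e he)

/-- **NECESSITY: 31770 ⟹ the `e = 1` model column** (LIFT `e = 1 ↦ e = 2`: the deep residual CONTAINS the shallow one).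
[folklore] -/
theorem defectOne_of_defectDeep (h : DefectWalksTerminateDeep) : DefectWalksTerminateOne :=
  fun p hp => defectAt_of_succ hp ((defectWalksTerminateDeep_iff_at.mp h) p hp 2 le_rfl)

/-- **EXACT CARVE OF 31770**: `DefectWalksTerminateDeep ⟺ PrimDefectWalksTerminateDeep ∧
DefectWalksTerminateOne`. [folklore] -/
theorem defectDeep_iff_prim_and_one :
    DefectWalksTerminateDeep ↔ PrimDefectWalksTerminateDeep ∧ DefectWalksTerminateOne := by
  refine ⟨fun h => ⟨primDefectDeep_of_defectDeep h, defectOne_of_defectDeep h⟩, fun h => ?_⟩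
  exact defectWalksTerminateDeep_iff_at.mpr fun p hp e he =>
    defectAt_of_prim_of_one hp (h.1 p hp) (h.2 p hp) e (one_le_two.trans he)

/-- **COLLAPSE OF THE `e`-AXIS IN THE MODEL**: the deep residual (31770) is EQUIVALENT to the whole-`e` residual, hence to
`WalksTerminate` — the `e = 1` column is a CONSEQUENCE of the `e ≥ 2` columns (lift), not an independent conjunct.
[folklore] -/
theorem defectDeep_iff_defect : DefectWalksTerminateDeep ↔ DefectWalksTerminate := by
  refine ⟨fun h => defectWalksTerminate_iff_at.mpr fun p hp e he => ?_, defectDeep_of_defect⟩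
  exact defectAt_antitone hp (Nat.le_succ e) ((defectWalksTerminateDeep_iff_at.mp h) p hp (e + 1) (Nat.succ_le_succ he))

/-- … and so `DefectWalksTerminateDeep ⟺ WalksTerminate ⟺ PrimWalksTerminate`. [folklore] -/
theorem defectDeep_iff_walks : DefectWalksTerminateDeep ↔ WalksTerminate :=
  defectDeep_iff_defect.trans walksTerminate_iff_defect.symm

/-- `DefectWalksTerminateOne ⟺ ∀ p, WalksTerminateAt p 1`. [folklore] -/
theorem defectOne_iff_walksOne : DefectWalksTerminateOne ↔ ∀ p : ℕ, p.Prime → WalksTerminateAt p 1 :=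
  ⟨fun h p hp => (walksAt_iff_defectAt hp le_rfl).mpr (h p hp), fun h p hp => (walksAt_iff_defectAt hp le_rfl).mp (h p hp)⟩

/-- **The `e = 1` model column is KNOWN-MOD-PORT**: Cossart–Piltant 2019 Thm. 1.5 (i) (tree fact BY NAME) through the
tree's valuative port `ShallowColumnPort` and the column-wise realisation port. [folklore] -/
theorem defectOne_of_cp (hCP : Literature.AlgebraicGeometry.Resolution.CossartPiltant2019LocalPermissible.{0})
    (hV : ShallowColumnPort) (hR : ShallowRealisation) : DefectWalksTerminateOne :=
  defectOne_iff_walksOne.mpr (hR (shallow_of_port hCP hV))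

/-- **ASSEMBLY of 31770 from the carve**: primitive deep residual ∧ the `e = 1` column. [folklore] -/
theorem defectDeep_of_prim_of_one (hP : PrimDefectWalksTerminateDeep) (h1 : DefectWalksTerminateOne) :
    DefectWalksTerminateDeep :=
  defectDeep_iff_prim_and_one.mpr ⟨hP, h1⟩

/-- **ASSEMBLY of 31770 modulo the CP fact and the two ports**: the primitive deep residual ALONE. [folklore] -/
theorem defectDeep_of_prim_cp (hCP : Literature.AlgebraicGeometry.Resolution.CossartPiltant2019LocalPermissible.{0})
    (hV : ShallowColumnPort) (hR : ShallowRealisation) (hP : PrimDefectWalksTerminateDeep) : DefectWalksTerminateDeep :=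
  defectDeep_of_prim_of_one hP (defectOne_of_cp hCP hV hR)

/-! ### The lens reading: base range, threshold, asymptotic regime (all PROVED) -/

/-- **THRESHOLD**: non-termination propagates UP the exponent axis — if column `e` fails then every column `e' ≥ e` fails.
[folklore] -/
theorem not_walksAt_mono (hp : p.Prime) {e e' : ℕ} (hle : e ≤ e') (h : ¬ WalksTerminateAt p e) :
    ¬ WalksTerminateAt p e' :=
  fun h' => h (walksAt_antitone hp hle h')

/-- **ASYMPTOTIC REGIME = EVERYTHING**: `WalksTerminate` holds iff, for every `p`, its columns hold for ARBITRARILY LARGE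
`e` (any theorem in the regime `e ≫ 1` decides all `e`). [folklore] -/
theorem walksTerminate_iff_frequently :
    WalksTerminate ↔ ∀ p : ℕ, p.Prime → ∀ N : ℕ, ∃ e, N ≤ e ∧ WalksTerminateAt p e := by
  refine ⟨fun h p hp N => ⟨N + 1, N.le_succ, (walksTerminate_iff_at.mp h) p hp (N + 1) N.succ_pos⟩, fun h => ?_⟩
  refine walksTerminate_iff_at.mpr fun p hp e _ => ?_
  obtain ⟨e', hle, he'⟩ := h p hp e
  exact walksAt_antitone hp hle he'

/-- **BASE RANGE**: columns `0` (empty) and `1` (KNOWN-MOD-PORT) — the finite range of the lens. [folklore] -/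
theorem walksAt_le_one_of_cp (hCP : Literature.AlgebraicGeometry.Resolution.CossartPiltant2019LocalPermissible.{0})
    (hV : ShallowColumnPort) (hR : ShallowRealisation) (hp : p.Prime) {e : ℕ} (he : e ≤ 1) : WalksTerminateAt p e :=
  walksAt_antitone hp he (hR (shallow_of_port hCP hV) p hp)

end Kernels

end Summit.ResolutionOfSingularities.ResolutionOfSingularities.Theorems.FrobeniusDescentClasses
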